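import Summits.KontsevichZagierPeriods.KontsevichZagierPeriods.Theses.FurushoPentagon
import Literature.NumberTheory.Transcendental.DrinfeldAssociatorRegularisation
import Literature.NumberTheory.Transcendental.DrinfeldAssociatorHexagonProofs
import Literature.NumberTheory.Transcendental.MZVShuffleRegularisationProofs
import Literature.NumberTheory.Transcendental.AssociatorsEvalProofs
import Literature.NumberTheory.Transcendental.AssociatorsHexagonProofs

/-!
# `PentagonInKZ`, line `logfree-gauge-corner-flatness`: stub `stub_halfEdgeUniversal` — algebra

Support file (crux `PentagonInKZ`, stmt-KontsevichZagierPeriods-11348, route FurushoPentagon) for the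
universal half-edge identity `A(Y,X) e^{λY} Φ_χ(X,Y) = A(X,Y) e^{λX}`: the **antipode** of the
shuffle Hopf algebra (`G⁻(w) = (-1)^{|w|} G(w̃)` is a two-sided inverse of a group-like `G`, again
group-like, from `Σ_{uv = w} (-1)^{|u|} ũ ш v = δ_{w,∅}`); the registered sub-stub
`halfEdgeUniversal_seriesIdentity` (`G e^{λy} Φ = A₀ e^{λx}` from `Φ = ⟨G⁻A₀, reg ·⟩`, by the
factorisation `Shuffle.factorisation` and the antipode); evaluation bookkeeping in a nilpotent
algebra (three-letter series at `(x, y, 0)`, letter exponentials); signs and words of the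
composition formula. Refs: Reutenauer, *Free Lie algebras* (1993), §1.5; Drinfeld (1991), §2.
-/

noncomputable section

open Literature.NumberTheory.Transcendental

namespace Summit.KontsevichZagierPeriods.FurushoPentagon.PentagonInKZ.HalfEdgeUniversal

section Antipode

variable {α : Type*}

/-- `Σ_{uv = W} (-1)^{|u|} (ũ c r) ш v = c · (r ш W)` (first letters from `W` cancel in pairs).
[cite: Reutenauer1993, §1.5] -/
theorem alt_sum_splits_shuffleSum_cons (W : List α) : ∀ (c : α) (r : List α),
    ∑ p ∈ NCSeries.splits W,
        ((-1 : ℚ) ^ p.1.length) • Shuffle.shuffleSum (p.1.reverse ++ c :: r) p.2 =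
      (Shuffle.shuffleSum r W).mapDomain (List.cons c) := by
  induction W with
  | nil => intro c r; rw [NCSeries.sum_splits_nil']; simp
  | cons a W ih =>
    intro c r
    rw [NCSeries.sum_splits_cons]
    have h : ∀ p : List α × List α, ((-1 : ℚ) ^ (a :: p.1).length) •
        Shuffle.shuffleSum ((a :: p.1).reverse ++ c :: r) p.2 =
          -(((-1 : ℚ) ^ p.1.length) • Shuffle.shuffleSum (p.1.reverse ++ a :: c :: r) p.2) := by
      intro p
      rw [List.length_cons, pow_succ, List.reverse_cons, List.append_assoc, List.singleton_append,
        mul_neg_one, neg_smul]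
    simp only [h, Finset.sum_neg_distrib, ih a (c :: r)]
    simp only [List.length_nil, pow_zero, one_smul, List.reverse_nil, List.nil_append]
    rw [Shuffle.shuffleSum_cons_cons]
    abel

/-- **The antipode identity of the shuffle Hopf algebra**: `Σ_{uv = W} (-1)^{|u|} ũ ш v = 0` for a
non-empty word `W`. [cite: Reutenauer1993, §1.5] -/
theorem alt_sum_splits_shuffleSum {W : List α} (hW : W ≠ []) :
    ∑ p ∈ NCSeries.splits W, ((-1 : ℚ) ^ p.1.length) • Shuffle.shuffleSum p.1.reverse p.2 = 0 := by
  obtain ⟨a, W, rfl⟩ := List.exists_cons_of_ne_nil hW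
  rw [NCSeries.sum_splits_cons]
  have h : ∀ p : List α × List α, ((-1 : ℚ) ^ (a :: p.1).length) •
      Shuffle.shuffleSum (a :: p.1).reverse p.2 =
        -(((-1 : ℚ) ^ p.1.length) • Shuffle.shuffleSum (p.1.reverse ++ [a]) p.2) := by
    intro p
    rw [List.length_cons, pow_succ, List.reverse_cons, mul_neg_one, neg_smul]
  simp only [h, Finset.sum_neg_distrib, alt_sum_splits_shuffleSum_cons W a []]
  simp

variable {K : Type*} [CommRing K] [Algebra ℚ K]

/-- Rational signs act as signs. [folklore] -/
theorem neg_one_pow_smul_eq_mul (n : ℕ) (x : K) : ((-1 : ℚ) ^ n) • x = (-1 : K) ^ n * x := by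
  rw [Algebra.smul_def, map_pow, map_neg, map_one]

/-- **Left antipode**: `G⁻ G = 1`, `G⁻(w) = (-1)^{|w|} G(w̃)`, `G` group-like. [cite: Reutenauer1993, §1.5] -/
theorem antipode_mul {G : NCSeries α K} (hG : NCSeries.IsGroupLike G) (Ginv : NCSeries α K)
    (hGinv : ∀ w, Ginv w = (-1 : K) ^ w.length * G w.reverse) : Ginv * G = 1 := by
  funext W
  rw [NCSeries.mul_apply]
  have h : ∀ p : List α × List α, Ginv p.1 * G p.2 =
      Shuffle.pair G (((-1 : ℚ) ^ p.1.length) • Shuffle.shuffleSum p.1.reverse p.2) := by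
    intro p
    rw [Shuffle.pair_smul, Shuffle.pair_shuffleSum_of_isGroupLike hG, neg_one_pow_smul_eq_mul, hGinv,
      mul_assoc]
  simp only [h, ← Shuffle.pair_sum]
  by_cases hW : W = []
  · subst hW; rw [NCSeries.sum_splits_nil']; simp [Shuffle.pair_single, hG.1]
  · rw [alt_sum_splits_shuffleSum hW, Shuffle.pair_zero]
    obtain ⟨a, W, rfl⟩ := List.exists_cons_of_ne_nil hW; rfl

/-- **Right antipode**: `G G⁻ = 1` (the left one for `w ↦ G(w̃)`, read backwards). [cite: Reutenauer1993, §1.5] -/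
theorem mul_antipode {G : NCSeries α K} (hG : NCSeries.IsGroupLike G) (Ginv : NCSeries α K)
    (hGinv : ∀ w, Ginv w = (-1 : K) ^ w.length * G w.reverse) : G * Ginv = 1 := by
  have h := antipode_mul (Shuffle.isGroupLike_reverse hG)
    (fun w => (-1 : K) ^ w.length * G w) (fun w => by simp)
  funext W
  have hW := congrFun h W.reverse
  rw [NCSeries.mul_apply] at hW ⊢
  have h1 : (1 : NCSeries α K) W.reverse = (1 : NCSeries α K) W := by
    cases W with
    | nil => rfl
    | cons a W =>
      obtain ⟨b, W', hW'⟩ := List.exists_cons_of_ne_nil (List.reverse_ne_nil_iff.mpr (List.cons_ne_nil a W))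
      rw [hW']; rfl
  rw [← h1, ← hW]
  refine Finset.sum_nbij' (fun p => (p.2.reverse, p.1.reverse)) (fun p => (p.2.reverse, p.1.reverse))
    ?_ ?_ (fun p _ => by simp) (fun p _ => by simp) ?_
  · intro p hp; rw [NCSeries.mem_splits] at hp ⊢; rw [← hp, List.reverse_append]
  · intro p hp; rw [NCSeries.mem_splits] at hp ⊢; rw [← List.reverse_reverse W, ← hp, List.reverse_append]
  · intro p _; dsimp only; rw [hGinv, List.reverse_reverse, List.length_reverse]; ring

/-- **The antipode of a group-like series is group-like.** [cite: Reutenauer1993, §1.5] -/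
theorem isGroupLike_antipode {G : NCSeries α K} (hG : NCSeries.IsGroupLike G) (Ginv : NCSeries α K)
    (hGinv : ∀ w, Ginv w = (-1 : K) ^ w.length * G w.reverse) : NCSeries.IsGroupLike Ginv := by
  have hr := Shuffle.isGroupLike_reverse hG
  refine ⟨by rw [hGinv]; simp [hG.1], fun u v => ?_⟩
  rw [hGinv, hGinv]
  have h : ∀ w ∈ MZV.shuffleWord u v, Ginv w = (-1 : K) ^ (u.length + v.length) * G w.reverse :=
    fun w hw => by rw [hGinv, MZV.length_of_mem_shuffleWord u v hw]
  rw [List.map_congr_left h]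
  have h2 : ((MZV.shuffleWord u v).map fun w => (-1 : K) ^ (u.length + v.length) * G w.reverse) =
      ((MZV.shuffleWord u v).map fun w => G w.reverse).map
        fun x => (-1 : K) ^ (u.length + v.length) * x := by
    rw [List.map_map]; rfl
  have h3 := hr.2 u v
  dsimp only at h3
  rw [h2, List.sum_map_mul_left, List.map_id', ← h3, pow_add]
  ring

end Antipode

section Eval

variable {R : Type} [CommRing R]

/-- Restriction along a relabelling of letters preserves group-likeness. [cite: Reutenauer1993, §1.5] -/
theorem isGroupLike_comp_map {α β : Type*} {T : NCSeries β R} (hT : NCSeries.IsGroupLike T)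
    (ι : α → β) : NCSeries.IsGroupLike (fun w => T (w.map ι) : NCSeries α R) := by
  refine ⟨by simpa using hT.1, fun u v => ?_⟩
  have h := hT.2 (u.map ι) (v.map ι)
  rw [Shuffle.shuffleWord_map, List.map_map] at h
  exact h

variable [Algebra ℚ R] {A : Type*} [Ring A] [Algebra R A]

/-- `ev_V(exp(ℓ c)) = e^{ℓ V_c}` on a nilpotent substitution. [folklore] -/
theorem evalTrunc_expLetter {α : Type*} [Fintype α] [DecidableEq α] (N : ℕ) (V : α → A)
    (hV : ∀ w : List α, N < w.length → (w.map V).prod = 0) (c : α) (ℓ : R) :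
    NCSeries.evalTrunc N V (Shuffle.expLetter c ℓ) = truncExp R N (ℓ • V c) := by
  rw [Shuffle.expLetter_eq_exp_smul, NCSeries.evalTrunc_exp N V hV (by simp), truncExp]
  refine Finset.sum_congr rfl fun m _ => ?_
  rw [NCSeries.evalTrunc_smul, NCSeries.evalTrunc_letter N V hV]

omit [Algebra ℚ R] in
/-- A three-letter series at `(x, y, 0)` is its two-letter restriction at `(x, y)`. [folklore] -/
theorem evalTrunc_vec3_eq_evalTrunc_bsub (N : ℕ) (T : NCSeries (Fin 3) R) (x y : A)
    (ι : Bool → Fin 3) (h0 : ι false = 0) (h1 : ι true = 1) :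
    NCSeries.evalTrunc N (![x, y, 0] : Fin 3 → A) T =
      NCSeries.evalTrunc N (NCSeries.bsub x y) (fun w => T (w.map ι) : NCSeries Bool R) := by
  classical
  have hι : Function.Injective ι := by
    intro a b hab
    cases a <;> cases b <;> simp_all
  have hcomp : (![x, y, 0] : Fin 3 → A) ∘ ι = NCSeries.bsub x y := by
    funext b; cases b <;> simp [h0, h1]
  rw [NCSeries.evalTrunc_eq_sum_wordsLE, NCSeries.evalTrunc_eq_sum_wordsLE]
  have himg : (NCSeries.wordsLE Bool N).image (List.map ι) ⊆ NCSeries.wordsLE (Fin 3) N := by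
    intro W hW
    obtain ⟨w, hw, rfl⟩ := Finset.mem_image.mp hW
    simpa using hw
  rw [← Finset.sum_subset himg, Finset.sum_image (fun u _ v _ h => List.map_injective_iff.mpr hι h)]
  · refine Finset.sum_congr rfl fun w _ => ?_
    rw [List.map_map, hcomp]
  · intro W hWN hW
    have h2 : (2 : Fin 3) ∈ W := by
      by_contra h2
      apply hW
      rw [NCSeries.mem_wordsLE] at hWN
      refine Finset.mem_image.mpr ⟨W.map (fun a => decide (a = 1)),
        by rw [NCSeries.mem_wordsLE]; simpa using hWN, ?_⟩
      rw [List.map_map]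
      conv_rhs => rw [← List.map_id W]
      refine List.map_congr_left fun a ha => ?_
      have ha2 : a ≠ 2 := fun h => h2 (h ▸ ha)
      fin_cases a
      · simpa using h0
      · simpa using h1
      · exact absurd rfl ha2
    rw [List.prod_eq_zero (List.mem_map.mpr ⟨2, h2, by simp⟩), smul_zero]

end Eval

section Assembly

variable {R : Type} [CommRing R] [Algebra ℚ R]

/-- If `S(v) = (-1)^{#1(v)} c(v)` on convergent words then `(-1)^{#1(W)} Σ_v reg(W)_v c(v) = ⟨S, reg W⟩`
(`reg` preserves `#1` and is supported on convergent words). [cite: IharaKanekoZagier2006, §3] -/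
theorem phi_eq_pair_reg (S φ : NCSeries Bool R) (c : List Bool → R)
    (hφ : ∀ W, φ W = (-1 : R) ^ (W.count true) * (MZV.shuffleReg W).sum
      (fun v a => a • (if MZV.IsConvergentWord v then c v else (0 : R))))
    (hS : ∀ v, MZV.IsConvergentWord v → S v = (-1 : R) ^ (v.count true) * c v) (W : List Bool) :
    φ W = Shuffle.pair S (Shuffle.reg false true W) := by
  rw [hφ, Shuffle.pair, Shuffle.reg_false_true_eq_shuffleReg, Finsupp.sum, Finsupp.sum, Finset.mul_sum]
  refine Finset.sum_congr rfl fun v hv => ?_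
  have hconv := MZV.isConvergentWord_of_mem_support_shuffleReg hv
  have hcount : v.count true = W.count true := by
    rw [← Shuffle.reg_false_true_eq_shuffleReg] at hv
    exact Shuffle.count_eq_of_mem_support_reg false true W hv true
  rw [if_pos hconv, hS v hconv, hcount, mul_smul_comm]

omit [Algebra ℚ R] in
/-- Coefficient of `G⁻ A₀` at a single letter. [folklore] -/
theorem antipode_mul_apply_singleton (A₀ G Ginv : NCSeries Bool R) (hA : A₀ [] = 1)
    (hG : ∀ w, G w = A₀ (w.map not)) (hGinv : ∀ w, Ginv w = (-1 : R) ^ w.length * G w.reverse)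
    (a : Bool) : (Ginv * A₀) [a] = A₀ [a] - A₀ [!a] := by
  rw [Shuffle.mul_apply_singleton, hGinv, hGinv, hG, hG, hA]
  simp [hA]
  ring

end Assembly

end Summit.KontsevichZagierPeriods.FurushoPentagon.PentagonInKZ.HalfEdgeUniversal

namespace Summit.KontsevichZagierPeriods.FurushoPentagon.PentagonInKZ

open HalfEdgeUniversal in
/-- **Registered sub-stub `halfEdgeUniversal_seriesIdentity`: the half-edge identity of series
from the regularised composition.** For a group-like `A₀` with `A₀(x) = 0`, `A₀(y) = λ`,
`G = A₀(Y,X)`, `G⁻` its antipode: if `Φ(W) = ⟨G⁻A₀, reg W⟩` for all `W` then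
`G · e^{λ y} · Φ = A₀ · e^{λ x}` — by the factorisation `e^{-λ y} S e^{λ x} = ⟨S, reg ·⟩` of the
group-like `S = G⁻A₀` (`S(y) = λ`, `S(x) = -λ`) and `G G⁻ = 1`. [cite: Drinfeld1991, §2] -/
theorem halfEdgeUniversal_seriesIdentity :
    ∀ (R : Type) [CommRing R] [Algebra ℚ R] (A₀ G Ginv φ : NCSeries Bool R) (L : R), NCSeries.IsGroupLike A₀ → A₀ [false] = 0 → A₀ [true] = L → (∀ w : List Bool, G w = A₀ (w.map not)) → (∀ w : List Bool, Ginv w = (-1 : R) ^ w.length * G w.reverse) → (∀ W : List Bool, φ W = Shuffle.pair (Ginv * A₀) (Shuffle.reg false true W)) → G * Shuffle.expLetter true L * φ = A₀ * Shuffle.expLetter false L := by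
  intro R _ _ A₀ G Ginv φ L hA hA0 hA1 hG hGinv hφ
  have hGgl : NCSeries.IsGroupLike G := by
    have hG' : G = fun w => A₀ (w.map not) := funext hG
    rw [hG']
    exact isGroupLike_comp_map hA not
  have hSgl : NCSeries.IsGroupLike (Ginv * A₀) := (isGroupLike_antipode hGgl Ginv hGinv).mul hA
  have hSt : (Ginv * A₀) [true] = L := by
    rw [antipode_mul_apply_singleton A₀ G Ginv hA.1 hG hGinv]; simp [hA0, hA1]
  have hSf : (Ginv * A₀) [false] = -L := by
    rw [antipode_mul_apply_singleton A₀ G Ginv hA.1 hG hGinv]; simp [hA0, hA1]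
  have hfac : φ = Shuffle.expLetter true (-L) * (Ginv * A₀) * Shuffle.expLetter false L := by
    funext W
    rw [hφ, ← Shuffle.factorisation hSgl (x := false) (y := true) (by decide) W, hSt, hSf, neg_neg]
  calc G * Shuffle.expLetter true L * φ
      = G * (Shuffle.expLetter true L * Shuffle.expLetter true (-L)) * (Ginv * A₀) *
          Shuffle.expLetter false L := by rw [hfac]; noncomm_ring
    _ = (G * Ginv) * A₀ * Shuffle.expLetter false L := by
        rw [Shuffle.expLetter_mul_expLetter_neg]; noncomm_ring
    _ = A₀ * Shuffle.expLetter false L := by rw [mul_antipode hGgl Ginv hGinv, one_mul]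

end Summit.KontsevichZagierPeriods.FurushoPentagon.PentagonInKZ

namespace Summit.KontsevichZagierPeriods.FurushoPentagon.PentagonInKZ.HalfEdgeUniversal


section Signs

/-- `∏_{i<|v|} (∓1)(vᵢ) = (-1)^{#1(v)}`. [folklore] -/
theorem prod_range_sign (v : List Bool) :
    ∏ i ∈ Finset.range v.length, (if v.getD i false then (-1 : ℤ) else 1) = (-1) ^ (v.count true) := by
  induction v with
  | nil => simp
  | cons c v ih =>
    rw [List.length_cons, Finset.prod_range_succ', List.count_cons]
    simp only [List.getD_cons_succ, List.getD_cons_zero, ih]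
    cases c <;> simp [pow_succ]

/-- Products of signs square to `1`. [folklore] -/
theorem prod_sign_mul_self {α : Type*} (s : Finset α) (f : α → Bool) {x y : ℤ} (hx : x * x = 1)
    (hy : y * y = 1) : (∏ i ∈ s, if f i then x else y) * (∏ i ∈ s, if f i then x else y) = 1 := by
  rw [← Finset.prod_mul_distrib]
  exact Finset.prod_eq_one fun i _ => by by_cases h : f i <;> simp [h, hx, hy]

/-- Signs of the composition formula: `(-1)^{#1(v)} ∏_{i<k} (±1)(vᵢ) ∏_{j<|v|-k} (∓1)(v_{k+j}) = (-1)^k`. [folklore] -/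
theorem sign_identity (v : List Bool) {k : ℕ} (hk : k ≤ v.length) :
    (-1 : ℤ) ^ (v.count true) * ((∏ i ∈ Finset.range k, if v.getD i false then (1 : ℤ) else -1) *
      ∏ j ∈ Finset.range (v.length - k), if v.getD (k + j) false then (-1 : ℤ) else 1) = (-1) ^ k := by
  obtain ⟨l, hl⟩ : ∃ l, v.length = k + l := ⟨v.length - k, by omega⟩
  have hsplit := prod_range_sign v
  rw [hl, Finset.prod_range_add] at hsplit
  rw [show v.length - k = l by omega, ← hsplit]
  have h1 : ∏ i ∈ Finset.range k, (if v.getD i false then (1 : ℤ) else -1) =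
      (-1) ^ k * ∏ i ∈ Finset.range k, (if v.getD i false then (-1 : ℤ) else 1) := by
    rw [← Finset.card_range k, ← Finset.prod_const, Finset.card_range, ← Finset.prod_mul_distrib]
    exact Finset.prod_congr rfl fun i _ => by cases v.getD i false <;> simp
  have hA := prod_sign_mul_self (Finset.range k) (fun i => v.getD i false) (x := -1) (y := 1)
    (by norm_num) (by norm_num)
  have hB := prod_sign_mul_self (Finset.range l) (fun j => v.getD (k + j) false) (x := -1) (y := 1)
    (by norm_num) (by norm_num)
  rw [h1]
  linear_combination ((-1 : ℤ) ^ k * ((∏ j ∈ Finset.range l, if v.getD (k + j) false then (-1 : ℤ) else 1) *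
    ∏ j ∈ Finset.range l, if v.getD (k + j) false then (-1 : ℤ) else 1)) * hA + ((-1 : ℤ) ^ k) * hB

end Signs

section Words

variable (ι : Bool → Fin 3) (h0 : ι false = 0) (h1 : ι true = 1)
include h0 h1

/-- Pole positions of the two letters in the chart of path `5`: `c(0) = 0`, `c(1) = 1`. [folklore] -/
theorem shift_apply (b : Bool) : (![0, 1, 2] : Fin 3 → ℝ) (ι b) = if b then 1 else 0 := by
  cases b <;> simp [h0, h1]

omit h0 in
/-- A binary word, empty or ending in `1`, reads as a path word not ending in `0`. [folklore] -/
theorem getLast?_map_ne {c : List Bool} (hc : c = [] ∨ c.getLast? = some true) :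
    (c.map ι).getLast? ≠ some 0 := by
  rcases hc with rfl | hc
  · simp
  · rw [List.getLast?_map, hc]
    simp [h1]

omit h0 h1

/-- Letters of a relabelled word. [folklore] -/
theorem get_map (c : List Bool) (i : Fin (c.map ι).length) : (c.map ι).get i = ι (c.getD i false) := by
  have hi : (i : ℕ) < c.length := by simpa using i.isLt
  rw [List.get_eq_getElem, List.getElem_map, List.getD_eq_getElem _ _ hi]

/-- Letters of the reversed exchanged prefix: position `i` carries `¬ v_{k-1-i}`. [folklore] -/
theorem get_take_reverse_map (v : List Bool) (k : ℕ)
    (i : Fin (((v.take k).reverse.map not).map ι).length) :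
    (((v.take k).reverse.map not).map ι).get i = ι (!(v.getD (Fin.rev i) false)) := by
  have hi : (i : ℕ) < (v.take k).length := by simpa using i.isLt
  have hk : (v.take k).length ≤ v.length := by simp
  have hlen : (((v.take k).reverse.map not).map ι).length = (v.take k).length := by simp
  have hrev : (Fin.rev i : ℕ) = (v.take k).length - 1 - i := by rw [Fin.val_rev]; omega
  rw [List.get_eq_getElem, List.getElem_map, List.getElem_map, List.getElem_reverse, List.getElem_take,
    hrev, List.getD_eq_getElem _ _ (by omega)]

/-- Letters of the suffix `v|^k`: position `j` carries `v_{k+j}`. [folklore] -/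
theorem get_drop_map (v : List Bool) (k : ℕ) (j : Fin ((v.drop k).map ι).length) :
    ((v.drop k).map ι).get j = ι (v.getD (k + j) false) := by
  have hj : k + (j : ℕ) < v.length := by have := j.isLt; simp at this; omega
  rw [List.get_eq_getElem, List.getElem_map, List.getElem_drop, List.getD_eq_getElem _ _ hj]

/-- The reversed exchanged prefix of a word starting with `0` is empty or ends in `1`. [folklore] -/
theorem take_reverse_map_not_spec (v : List Bool) (hv0 : v.head? = some false) (k : ℕ) :
    (v.take k).reverse.map not = [] ∨ ((v.take k).reverse.map not).getLast? = some true := by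
  cases k with
  | zero => left; simp
  | succ k =>
    right
    cases v with
    | nil => simp at hv0
    | cons a v' =>
      simp only [List.head?_cons, Option.some.injEq] at hv0
      subst hv0
      simp

/-- A suffix of a word ending in `1` is empty or ends in `1`. [folklore] -/
theorem drop_spec (v : List Bool) (hv1 : v.getLast? = some true) (k : ℕ) :
    v.drop k = [] ∨ (v.drop k).getLast? = some true := by
  by_cases hk : v.length ≤ k
  · exact Or.inl (List.drop_eq_nil_of_le hk)
  · right
    rw [List.getLast?_drop, if_neg (by omega), hv1]

end Words

/-- `regEnd_x(w) = w` for `w` not ending in `x`. [cite: IharaKanekoZagier2006, Cor. 5] -/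
theorem regEnd_eq_single {α : Type*} [DecidableEq α] {x : α} {w : List α} (hw : w.getLast? ≠ some x) :
    Shuffle.regEnd x w = Finsupp.single w 1 := by
  unfold Shuffle.regEnd Shuffle.regFront
  have hl : Shuffle.leadCount x w.reverse = 0 := by
    cases h : w.reverse with
    | nil => rfl
    | cons c r =>
      refine Shuffle.leadCount_cons_of_ne (fun hc => hw ?_) r
      rw [← List.head?_reverse, h, hc]; rfl
  rw [hl, Finset.sum_range_one]
  simp

/-- `regEnd_x(x) = 0`. [cite: IharaKanekoZagier2006, Cor. 5] -/
theorem regEnd_singleton_self {α : Type*} [DecidableEq α] (x : α) : Shuffle.regEnd x [x] = 0 := by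
  unfold Shuffle.regEnd Shuffle.regFront
  rw [List.reverse_singleton, Shuffle.leadCount_cons_self, Shuffle.leadCount_nil, Finset.sum_range_succ,
    Finset.sum_range_one]
  simp [Shuffle.shuffleSum, Shuffle.wordSum]

/-- A map killing the relations identifies congruent classes. [folklore] -/
theorem chi_eq_of_sub_mem {R : Type} [AddCommGroup R] (χ : KZ.FormalRep →+ R)
    (hrel : ∀ c ∈ KZ.relations, χ c = 0) {x y : KZ.FormalRep} (h : x - y ∈ KZ.relations) : χ x = χ y := by
  have := hrel _ h
  rwa [map_sub, sub_eq_zero] at this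

end Summit.KontsevichZagierPeriods.FurushoPentagon.PentagonInKZ.HalfEdgeUniversal
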